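import Summits.CriticalPhenomena.PercolationContinuityZ3.Theorems.PercNearOneGluingNoHeavyLowerTailThreePointProductFormFibreTreeParent
import HarnessLib

/-!
# (P) on tree-like fibres, VII: the apex's trunk component is a tree — everything else arbitrary (Sahi programme, prover prim-sahi-p2 gen 60)

Support file (`--supports stmt-CriticalPhenomena-4575`, helper); continues `…FibreTreeParent` (same gen).  Standard axioms, no sorries, no named
facts, no definitions.  Memo `run/shared/lean/prim/prim-sahi/FROM-prim-sahi-p2-gen60-CYCLE-COMPOSITION.md` §6; `prim-sahi-p2/PROOF-E3.md` §70.

`productForm_of_treeParent` requires EVERY label to be a trunk label of the apex's tree or a mark at one of its vertices.  Here the remaining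
labels are arbitrary as long as they avoid the tree: a label class with no endpoint in `T` (other trunk components with any multiplicities and
loops, `s–c` labels, loops at `s`, `c`, …) is a piece glued at `{s, c}` only; by the PARALLEL COMPOSITION LAW at `{s,a,c}` (`…FibreParallelCounts`,
gen 59) its six statistics multiply those of the tree part, and since the apex is isolated in it, all six of its statistics coincide (§1), so
`(#bad, #P1, #P2)` of the whole multigraph are a common positive multiple of those of the tree part (§2).
* §1 `eq_apex_of_reachable_restrict`, `flat_restrict_eq_of_apexFree`: a label class avoiding the apex leaves the apex isolated and is fixed by the
  restricted flat.
* §2 **`productForm_of_apexTree`**: CONJECTURE (P) `#bad² ≤ #P1·#P2` for every finite multigraph in which the trunk component of the apex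
  (parent-pointer tree `T, par, dep, e` as in `…FibreTreeParent`) is a simple tree and every other label is a mark at a vertex of `T` or avoids `T`
  — i.e. (P) ON 𝒯 for simple trunk labels in the apex's component, as a statement about the multigraph (gen 59 THEOREM (P) on 𝒯, memo §2).
[this work] (gen 60); [cite: Gladkov2024, Conjecture 10.1 (p. 18), arXiv:2408.08457] for (P).
-/

namespace Summit.CriticalPhenomena.PercolationContinuityZ3.Theorems.ProductFormFibre

open Finset Literature.Probability.Percolation
open Summit.CriticalPhenomena.PercolationContinuityZ3.Theorems.ThreePointCPIClusterSwap
  (QTouch clusterFlip clusterFlip_of_qtouch clusterFlip_of_not_qtouch)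

variable {V α : Type*}

/-! ### §1. Label classes avoiding the apex -/
section ApexFree

variable (ends : α → Sym2 V) (a : V) (Q : α → Prop) [DecidablePred Q]

/-- If no label of the class `Q` contains the apex, the apex is isolated in every `Q`-restricted configuration. [this work] -/
theorem eq_apex_of_reachable_restrict (hQ : ∀ l, Q l → a ∉ ends l) (z : α → Bool) {v : V}
    (h : (openGraph (labelledOpen ends fun l => z l && decide (Q l))).Reachable a v) : v = a := by
  obtain ⟨p⟩ := h
  cases p with
  | nil => rfl
  | cons hadj _ =>
    exfalso
    rw [openGraph_adj] at hadj
    obtain ⟨⟨l, hl, hle⟩, -⟩ := hadj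
    simp only [Bool.and_eq_true, decide_eq_true_eq] at hl
    exact hQ l hl.2 (by rw [hle]; exact Sym2.mem_mk_left _ _)

/-- If no label of `Q` contains the apex, the restricted flat of a `Q`-restricted configuration is the configuration itself. [this work] -/
theorem flat_restrict_eq_of_apexFree (hQ : ∀ l, Q l → a ∉ ends l) (z : α → Bool) :
    (fun l => clusterFlip ends a (fun y => !(z y && decide (Q y))) l && decide (Q l)) = fun l => z l && decide (Q l) := by
  funext l
  by_cases hq : Q l
  · have hnt : ¬ QTouch ends a (fun y => !(z y && decide (Q y))) l := by
      rw [qtouch_compl_iff]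
      rintro ⟨v, hv, hr⟩
      exact hQ l hq ((eq_apex_of_reachable_restrict ends a Q hQ z hr) ▸ hv)
    rw [clusterFlip_of_not_qtouch ends a _ hnt, Bool.not_not]
    simp [hq]
  · simp [hq]

end ApexFree
/-! ### §1b. The final arithmetic -/

/-- Bookkeeping: if the six statistics of the whole are `N/U` times those of a part, so are `(#bad, #P1, #P2)`, and (P) transfers. [this work] -/
theorem productForm_transfer_arith (B G S G1 Ga Gb IC IS Pa Pb B1 G' S1 G11 Ga1 Gb1 IC1 IS1 Pa1 Pb1 N U : ℕ) (hU : 0 < U)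
    (c12a : B + G = S) (c12b : G + G1 = Ga + Gb) (c12c : Pa + S = IC) (c12d : Pb + S = IS)
    (c1a : B1 + G' = S1) (c1b : G' + G11 = Ga1 + Gb1) (c1c : Pa1 + S1 = IC1) (c1d : Pb1 + S1 = IS1)
    (lS : S * U = S1 * N) (lC : IC * U = IC1 * N) (lIS : IS * U = IS1 * N) (lGa : Ga * U = Ga1 * N)
    (lGb : Gb * U = Gb1 * N) (lG1 : G1 * U = G11 * N) (key : B1 ^ 2 ≤ Pa1 * Pb1) : B ^ 2 ≤ Pa * Pb := by
  have hPa : (Pa : ℤ) * U = Pa1 * N := by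
    zify at c12c c1c lC lS; linear_combination (U : ℤ) * c12c - (N : ℤ) * c1c + lC - lS
  have hPb : (Pb : ℤ) * U = Pb1 * N := by
    zify at c12d c1d lIS lS; linear_combination (U : ℤ) * c12d - (N : ℤ) * c1d + lIS - lS
  have hG : (G : ℤ) * U = G' * N := by
    zify at c12b c1b lGa lGb lG1; linear_combination (U : ℤ) * c12b - (N : ℤ) * c1b + lGa + lGb - lG1
  have hB : (B : ℤ) * U = B1 * N := by
    zify at c12a c1a lS; linear_combination (U : ℤ) * c12a - (N : ℤ) * c1a + lS - hG
  have keyZ : ((B1 : ℤ)) ^ 2 ≤ Pa1 * Pb1 := by exact_mod_cast key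
  have hN : (0 : ℤ) ≤ (N : ℤ) ^ 2 := sq_nonneg _
  have h0 := mul_le_mul_of_nonneg_right keyZ hN
  have h1 : ((B : ℤ) * U) ^ 2 ≤ ((Pa : ℤ) * U) * ((Pb : ℤ) * U) := by
    rw [hB, hPa, hPb]
    calc ((B1 : ℤ) * N) ^ 2 = (B1 : ℤ) ^ 2 * (N : ℤ) ^ 2 := by ring
      _ ≤ (Pa1 : ℤ) * Pb1 * (N : ℤ) ^ 2 := h0
      _ = ((Pa1 : ℤ) * N) * ((Pb1 : ℤ) * N) := by ring
  have hU' : (0 : ℤ) < (U : ℤ) ^ 2 := by positivity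
  have h3 : ((B : ℤ)) ^ 2 * (U : ℤ) ^ 2 ≤ ((Pa : ℤ) * Pb) * (U : ℤ) ^ 2 := by
    calc ((B : ℤ)) ^ 2 * (U : ℤ) ^ 2 = ((B : ℤ) * U) ^ 2 := by ring
      _ ≤ ((Pa : ℤ) * U) * ((Pb : ℤ) * U) := h1
      _ = ((Pa : ℤ) * Pb) * (U : ℤ) ^ 2 := by ring
  have h2 : ((B : ℤ)) ^ 2 ≤ Pa * Pb := le_of_mul_le_mul_right h3 hU'
  exact_mod_cast h2

/-! ### §2. The theorem -/

section ApexTree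

variable [Fintype α] [DecidableEq α] [Fintype V] [DecidableEq V] (ends : α → Sym2 V) (s c a : V)
  (T : Finset V) (par : V → V) (dep : V → ℕ) (e : V → α)

open Classical in
/-- **CONJECTURE (P) WHENEVER THE APEX'S TRUNK COMPONENT IS A SIMPLE TREE.**  Let `T ∌ s, c` be a finite set of vertices containing `a` with
parent map `par`, depth `dep` (`dep a = 0`; `par v ∈ T`, `dep (par v) + 1 = dep v` for `v ∈ T ∖ {a}`) and a label `e v : par v — v` for each
`v ∈ T ∖ {a}`; suppose every label is one of these, or a mark `x — s` / `x — c` at some `x ∈ T`, or has NO endpoint in `T` (arbitrary).  Then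
`#{a ↮ s, a ↮ c, s ↮ c in z, s ↔ c in ♭z}² ≤ #{a ↔ s, a ↮ c} · #{a ↔ c, a ↮ s}` (`♭z = clusterFlip ends a z̄`). [this work] -/
theorem productForm_of_apexTree (hsc : s ≠ c) (hsT : s ∉ T) (hcT : c ∉ T) (haT : a ∈ T)
    (hda : dep a = 0)
    (hdep : ∀ v ∈ T, v ≠ a → par v ∈ T ∧ dep (par v) + 1 = dep v)
    (he : ∀ v ∈ T, v ≠ a → ends (e v) = s(par v, v))
    (hlab : ∀ l, (∃ v ∈ T, v ≠ a ∧ l = e v) ∨ (∃ x ∈ T, ends l = s(x, s) ∨ ends l = s(x, c)) ∨ (∀ x ∈ ends l, x ∉ T)) :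
    (univ.filter fun z : α → Bool =>
        (¬ (openGraph (labelledOpen ends z)).Reachable a s ∧ ¬ (openGraph (labelledOpen ends z)).Reachable a c ∧
          ¬ (openGraph (labelledOpen ends z)).Reachable s c) ∧
        (openGraph (labelledOpen ends (clusterFlip ends a fun x => !z x))).Reachable s c).card ^ 2 ≤
    (univ.filter fun z : α → Bool =>
        (openGraph (labelledOpen ends z)).Reachable a s ∧ ¬ (openGraph (labelledOpen ends z)).Reachable a c).card *
    (univ.filter fun z : α → Bool =>
        (openGraph (labelledOpen ends z)).Reachable a c ∧ ¬ (openGraph (labelledOpen ends z)).Reachable a s).card := by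
  -- the ancestor relation and the concrete tree structure
  let Anc : V → V → Prop := fun v x => x ∈ T ∧ v ∈ T ∧ dep v ≤ dep x ∧ par^[dep x - dep v] x = v
  let Tp : V → Prop := fun v => v ∈ T
  let ch : V → Finset V := fun v => T.filter fun u => u ≠ a ∧ par u = v
  let M : ℕ := T.sup dep
  let ht : V → ℕ := fun v => M - dep v
  let Ms : V → Finset α := fun v => univ.filter fun l => ends l = s(v, s)
  let Mc : V → Finset α := fun v => univ.filter fun l => ends l = s(v, c)
  let mQ : V → α → Bool := fun v l =>
    decide ((∃ u ∈ T, u ≠ a ∧ l = e u ∧ Anc v u ∧ u ≠ v) ∨ (∃ x, Anc v x ∧ (ends l = s(x, s) ∨ ends l = s(x, c))))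
  have anc_refl' : ∀ x ∈ T, Anc x x := fun x hx => ⟨hx, hx, le_rfl, by simp⟩
  have anc_trans' : ∀ {v u x}, Anc v u → Anc u x → Anc v x := by
    intro v u x h1 h2
    exact ⟨h2.1, h1.2.1, anc_trans par dep ⟨h1.2.2.1, h1.2.2.2⟩ ⟨h2.2.2.1, h2.2.2.2⟩⟩
  have mem_ch : ∀ v u, u ∈ ch v ↔ u ∈ T ∧ u ≠ a ∧ par u = v := by
    intro v u; simp only [ch, Finset.mem_filter]
  have dep_ch : ∀ v, v ∈ T → ∀ u ∈ ch v, dep u = dep v + 1 := by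
    intro v hv u hu
    obtain ⟨huT, hua, hpu⟩ := (mem_ch v u).mp hu
    have := (hdep u huT hua).2; rw [hpu] at this; omega
  have anc_of_ch : ∀ v, v ∈ T → ∀ u ∈ ch v, Anc v u := by
    intro v hv u hu
    obtain ⟨huT, hua, hpu⟩ := (mem_ch v u).mp hu
    have hd := dep_ch v hv u hu
    refine ⟨huT, hv, by omega, ?_⟩
    have : dep u - dep v = 1 := by omega
    rw [this]; simpa using hpu
  -- a proper ancestor passes through a child
  have anc_child' : ∀ {v x}, Anc v x → x ≠ v → ∃ u ∈ ch v, Anc u x := by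
    intro v x h hne
    obtain ⟨hm, hna, hpar, hdu, hanc⟩ := anc_child T a par dep hda hdep h.1 ⟨h.2.2.1, h.2.2.2⟩ hne
    exact ⟨_, (mem_ch v _).mpr ⟨hm, hna, hpar⟩, h.1, hm, hanc⟩
  -- the recursive description of the masks
  have hmQ : ∀ v, Tp v → ∀ l, (mQ v l = true ↔ (∃ u ∈ ch v, l = e u ∨ mQ u l = true) ∨ l ∈ Ms v ∨ l ∈ Mc v) := by
    intro v hv l
    simp only [mQ, decide_eq_true_eq, Ms, Mc, Finset.mem_filter, Finset.mem_univ, true_and]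
    constructor
    · rintro (⟨u, huT, hua, rfl, hanc, hne⟩ | ⟨x, hanc, hl⟩)
      · -- trunk label below v
        obtain ⟨u₁, hu₁, h1⟩ := anc_child' hanc hne
        by_cases hu1 : u = u₁
        · subst hu1; exact Or.inl ⟨u, hu₁, Or.inl rfl⟩
        · exact Or.inl ⟨u₁, hu₁, Or.inr (Or.inl ⟨u, huT, hua, rfl, h1, hu1⟩)⟩
      · by_cases hxv : x = v
        · subst hxv
          rcases hl with hl | hl
          · exact Or.inr (Or.inl hl)
          · exact Or.inr (Or.inr hl)
        · obtain ⟨u₁, hu₁, h1⟩ := anc_child' hanc hxv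
          exact Or.inl ⟨u₁, hu₁, Or.inr (Or.inr ⟨x, h1, hl⟩)⟩
    · rintro (⟨u, hu, hl⟩ | hl | hl)
      · have hvu := anc_of_ch v hv u hu
        have hdu := dep_ch v hv u hu
        obtain ⟨huT, hua, hpu⟩ := (mem_ch v u).mp hu
        rcases hl with rfl | (⟨u', hu'T, hu'a, rfl, hanc, hne⟩ | ⟨x, hanc, hl⟩)
        · exact Or.inl ⟨u, huT, hua, rfl, hvu, fun h => by rw [h] at hdu; omega⟩
        · refine Or.inl ⟨u', hu'T, hu'a, rfl, anc_trans' hvu hanc, fun h => ?_⟩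
          rw [h] at hanc; have := hanc.2.2.1; omega
        · exact Or.inr ⟨x, anc_trans' hvu hanc, hl⟩
      · exact Or.inr ⟨v, anc_refl' v hv, Or.inl hl⟩
      · exact Or.inr ⟨v, anc_refl' v hv, Or.inr hl⟩
  have key := productForm_of_treeStructure ends s c Tp ch ht mQ Anc e Ms Mc hsc
    (fun v hv => ⟨fun h => hsT (h ▸ hv), fun h => hcT (h ▸ hv)⟩)
    (fun v hv u hu => by
      obtain ⟨huT, hua, hpu⟩ := (mem_ch v u).mp hu
      have hd := dep_ch v hv u hu
      have hM : dep u ≤ M := Finset.le_sup (f := dep) huT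
      exact ⟨huT, by show M - dep u < M - dep v; omega⟩)
    (fun v hv u hu => by
      obtain ⟨huT, hua, hpu⟩ := (mem_ch v u).mp hu
      rw [he u huT hua, hpu])
    (fun v hv m hm => by simpa [Ms] using hm) (fun v hv m hm => by simpa [Mc] using hm)
    hmQ
    (fun u hu => anc_refl' u hu)
    (fun u hu l hl => by
      simp only [mQ, decide_eq_true_eq] at hl
      rcases hl with ⟨u', hu'T, hu'a, rfl, hanc, hne⟩ | ⟨x, hanc, hl⟩
      · -- the trunk label `e u'` with `u'` strictly below `u`: both endpoints are below `u`
        have hpar' : Anc u (par u') := by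
          obtain ⟨hm, hna, hpar, hdu, hanc1⟩ := anc_child T a par dep hda hdep hanc.1 ⟨hanc.2.2.1, hanc.2.2.2⟩ hne
          -- `par u'` is the ancestor of `u'` one level up; it is below `u`
          have h1 : Anc (par u') u' := by
            refine ⟨hu'T, (hdep u' hu'T hu'a).1, by have := (hdep u' hu'T hu'a).2; omega, ?_⟩
            have : dep u' - dep (par u') = 1 := by have := (hdep u' hu'T hu'a).2; omega
            rw [this]; simp
          -- `u` is an ancestor of `u'` different from `u'`, so an ancestor of `par u'`
          refine ⟨(hdep u' hu'T hu'a).1, hanc.2.1, ?_, ?_⟩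
          · have := (hdep u' hu'T hu'a).2
            rcases Nat.lt_or_ge (dep u) (dep u') with h | h
            · omega
            · exfalso
              have h0 : dep u' - dep u = 0 := by omega
              have := hanc.2.2.2; rw [h0] at this; simp at this; exact hne this
          · have hd := (hdep u' hu'T hu'a).2
            have : dep (par u') - dep u = (dep u' - dep u) - 1 := by omega
            rw [this]
            have h2 := hanc.2.2.2
            have hk : dep u' - dep u = (dep u' - dep u - 1) + 1 := by
              rcases Nat.lt_or_ge (dep u) (dep u') with h | h
              · omega
              · exfalso
                have h0 : dep u' - dep u = 0 := by omega
                rw [h0] at h2; simp at h2; exact hne h2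
            rw [hk, Function.iterate_succ_apply] at h2
            exact h2
        rw [he u' hu'T hu'a]
        refine ⟨fun x hx => ?_, ⟨u', Sym2.mem_mk_right _ _, hanc⟩⟩
        rcases Sym2.mem_iff.mp hx with rfl | rfl
        · exact Or.inl hpar'
        · exact Or.inl hanc
      · rcases hl with hl | hl <;> rw [hl]
        · exact ⟨fun y hy => by
            rcases Sym2.mem_iff.mp hy with rfl | rfl
            · exact Or.inl hanc
            · exact Or.inr (Or.inl rfl), ⟨x, Sym2.mem_mk_left _ _, hanc⟩⟩
        · exact ⟨fun y hy => by
            rcases Sym2.mem_iff.mp hy with rfl | rfl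
            · exact Or.inl hanc
            · exact Or.inr (Or.inr rfl), ⟨x, Sym2.mem_mk_left _ _, hanc⟩⟩)
    (fun u hu x hx => ⟨fun h => hsT (h ▸ hx.1), fun h => hcT (h ▸ hx.1)⟩)
    (fun v hv u hu x hx => by
      intro hxv
      have hd := dep_ch v hv u hu
      have := hx.2.2.1; rw [hxv] at this; omega)
    (fun v hv u hu u' hu' hne x hx hx' => by
      have hd := dep_ch v hv u hu
      have hd' := dep_ch v hv u' hu'
      have h1 := hx.2.2.2; have h2 := hx'.2.2.2
      rw [hd] at h1; rw [hd'] at h2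
      exact hne (h1.symm.trans h2))
    a haT
  -- §§ the two label classes
  let Q₁ : α → Prop := fun l =>
    (∃ u ∈ T, u ≠ a ∧ l = e u ∧ Anc a u ∧ u ≠ a) ∨ (∃ x, Anc a x ∧ (ends l = s(x, s) ∨ ends l = s(x, c)))
  let Q₂ : α → Prop := fun l => ∀ x ∈ ends l, x ∉ T
  let P₁ : V → Prop := fun v => v ∈ T ∧ v ≠ a
  let P₂ : V → Prop := fun v => v ∉ T ∧ v ≠ s ∧ v ≠ c
  have hmQ₁ : mQ a = fun l => decide (Q₁ l) := rfl
  have anc_a : ∀ x ∈ T, Anc a x := by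
    intro x hx
    refine ⟨hx, haT, by rw [hda]; exact Nat.zero_le _, ?_⟩
    rw [hda, Nat.sub_zero]; exact iterate_par_dep T a par dep hda hdep x hx
  have has : a ≠ s := fun h => hsT (h ▸ haT)
  have hac : a ≠ c := fun h => hcT (h ▸ haT)
  have hQP₁ : ∀ l, Q₁ l → ∀ v ∈ ends l, P₁ v ∨ (v = s ∨ v = a ∨ v = c) := by
    intro l hl v hv
    rcases hl with ⟨u, huT, hua, rfl, -, -⟩ | ⟨x, hx, hl⟩
    · rw [he u huT hua] at hv
      rcases Sym2.mem_iff.mp hv with rfl | rfl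
      · by_cases hpa : par u = a
        · exact Or.inr (Or.inr (Or.inl hpa))
        · exact Or.inl ⟨(hdep u huT hua).1, hpa⟩
      · exact Or.inl ⟨huT, hua⟩
    · have hxT : x ∈ T := hx.1
      rcases hl with hl | hl <;> rw [hl] at hv <;> rcases Sym2.mem_iff.mp hv with rfl | rfl
      · by_cases hxa : v = a
        · exact Or.inr (Or.inr (Or.inl hxa))
        · exact Or.inl ⟨hxT, hxa⟩
      · exact Or.inr (Or.inl rfl)
      · by_cases hxa : v = a
        · exact Or.inr (Or.inr (Or.inl hxa))
        · exact Or.inl ⟨hxT, hxa⟩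
      · exact Or.inr (Or.inr (Or.inr rfl))
  have hQP₂ : ∀ l, Q₂ l → ∀ v ∈ ends l, P₂ v ∨ (v = s ∨ v = a ∨ v = c) := by
    intro l hl v hv
    by_cases hvs : v = s
    · exact Or.inr (Or.inl hvs)
    by_cases hvc : v = c
    · exact Or.inr (Or.inr (Or.inr hvc))
    exact Or.inl ⟨hl v hv, hvs, hvc⟩
  have hPT₁ : ∀ v, P₁ v → ¬ (v = s ∨ v = a ∨ v = c) := by
    rintro v ⟨hv, hva⟩ (rfl | rfl | rfl)
    · exact hsT hv
    · exact hva rfl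
    · exact hcT hv
  have hPT₂ : ∀ v, P₂ v → ¬ (v = s ∨ v = a ∨ v = c) := by
    rintro v ⟨hv, hvs, hvc⟩ (rfl | rfl | rfl)
    · exact hvs rfl
    · exact hv haT
    · exact hvc rfl
  have hP : ∀ v, P₁ v → ¬ P₂ v := fun v h1 h2 => h2.1 h1.1
  have hQ : ∀ l, Q₁ l → ¬ Q₂ l := by
    intro l hl h2
    rcases hl with ⟨u, huT, hua, rfl, -, -⟩ | ⟨x, hx, hl⟩
    · exact h2 u (by rw [he u huT hua]; exact Sym2.mem_mk_right _ _) huT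
    · rcases hl with hl | hl
      · exact h2 x (by rw [hl]; exact Sym2.mem_mk_left _ _) hx.1
      · exact h2 x (by rw [hl]; exact Sym2.mem_mk_left _ _) hx.1
  have hQ₂a : ∀ l, Q₂ l → a ∉ ends l := fun l hl h => hl a h haT
  -- §§ the junk class: apex isolated, flat trivial, all six statistics equal
  have nra : ∀ z : α → Bool, ¬ (openGraph (labelledOpen ends fun l => z l && decide (Q₂ l))).Reachable s a ∧
      ¬ (openGraph (labelledOpen ends fun l => z l && decide (Q₂ l))).Reachable c a := by
    intro z
    exact ⟨fun h => has (eq_apex_of_reachable_restrict ends a Q₂ hQ₂a z h.symm).symm,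
      fun h => hac (eq_apex_of_reachable_restrict ends a Q₂ hQ₂a z h.symm).symm⟩
  have nrc : ∀ z : α → Bool, ¬ (openGraph (labelledOpen ends fun l => z l && decide (Q₂ l))).Reachable a s ∧
      ¬ (openGraph (labelledOpen ends fun l => z l && decide (Q₂ l))).Reachable a c := by
    intro z
    exact ⟨fun h => has (eq_apex_of_reachable_restrict ends a Q₂ hQ₂a z h).symm,
      fun h => hac (eq_apex_of_reachable_restrict ends a Q₂ hQ₂a z h).symm⟩
  have rsym : ∀ z : α → Bool, (openGraph (labelledOpen ends fun l => z l && decide (Q₂ l))).Reachable c s ↔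
      (openGraph (labelledOpen ends fun l => z l && decide (Q₂ l))).Reachable s c :=
    fun z => ⟨fun h => h.symm, fun h => h.symm⟩
  have nS0 : (univ.filter fun z : α → Bool => ((¬ (openGraph (labelledOpen ends fun l => z l && decide (Q₂ l))).Reachable s a ∧ ¬ (openGraph (labelledOpen ends fun l => z l && decide (Q₂ l))).Reachable s c) ∧ (¬ (openGraph (labelledOpen ends fun l => z l && decide (Q₂ l))).Reachable c a ∧ ¬ (openGraph (labelledOpen ends fun l => z l && decide (Q₂ l))).Reachable c s))).card = (univ.filter fun z : α → Bool => ¬ (openGraph (labelledOpen ends fun l => z l && decide (Q₂ l))).Reachable s c).card := by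
    congr 1
    apply Finset.filter_congr
    intro z _
    have h1 := nra z; have h2 := nrc z; have h3 := fun h => (rsym z).mp h; have h4 := fun h => (rsym z).mpr h
    tauto
  have nisoC : (univ.filter fun z : α → Bool => (¬ (openGraph (labelledOpen ends fun l => z l && decide (Q₂ l))).Reachable c a ∧ ¬ (openGraph (labelledOpen ends fun l => z l && decide (Q₂ l))).Reachable c s)).card = (univ.filter fun z : α → Bool => ¬ (openGraph (labelledOpen ends fun l => z l && decide (Q₂ l))).Reachable s c).card := by
    congr 1
    apply Finset.filter_congr
    intro z _
    have h1 := nra z; have h2 := nrc z; have h3 := fun h => (rsym z).mp h; have h4 := fun h => (rsym z).mpr h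
    tauto
  have nisoS : (univ.filter fun z : α → Bool => (¬ (openGraph (labelledOpen ends fun l => z l && decide (Q₂ l))).Reachable s a ∧ ¬ (openGraph (labelledOpen ends fun l => z l && decide (Q₂ l))).Reachable s c)).card = (univ.filter fun z : α → Bool => ¬ (openGraph (labelledOpen ends fun l => z l && decide (Q₂ l))).Reachable s c).card := by
    congr 1
    apply Finset.filter_congr
    intro z _
    have h1 := nra z; have h2 := nrc z; have h3 := fun h => (rsym z).mp h; have h4 := fun h => (rsym z).mpr h
    tauto
  have nGa : (univ.filter fun z : α → Bool => (((¬ (openGraph (labelledOpen ends fun l => z l && decide (Q₂ l))).Reachable s a ∧ ¬ (openGraph (labelledOpen ends fun l => z l && decide (Q₂ l))).Reachable s c) ∧ (¬ (openGraph (labelledOpen ends fun l => z l && decide (Q₂ l))).Reachable c a ∧ ¬ (openGraph (labelledOpen ends fun l => z l && decide (Q₂ l))).Reachable c s)) ∧ (¬ (openGraph (labelledOpen ends fun l => clusterFlip ends a (fun y => !(z y && decide (Q₂ y))) l && decide (Q₂ l))).Reachable c a ∧ ¬ (openGraph (labelledOpen ends fun l => clusterFlip ends a (fun y => !(z y &&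 decide (Q₂ y))) l && decide (Q₂ l))).Reachable c s))).card = (univ.filter fun z : α → Bool => ¬ (openGraph (labelledOpen ends fun l => z l && decide (Q₂ l))).Reachable s c).card := by
    congr 1
    apply Finset.filter_congr
    intro z _
    rw [flat_restrict_eq_of_apexFree ends a Q₂ hQ₂a z]
    have h1 := nra z; have h2 := nrc z; have h3 := fun h => (rsym z).mp h; have h4 := fun h => (rsym z).mpr h
    tauto
  have nGb : (univ.filter fun z : α → Bool => (((¬ (openGraph (labelledOpen ends fun l => z l && decide (Q₂ l))).Reachable s a ∧ ¬ (openGraph (labelledOpen ends fun l => z l && decide (Q₂ l))).Reachable s c) ∧ (¬ (openGraph (labelledOpen ends fun l => z l && decide (Q₂ l))).Reachable c a ∧ ¬ (openGraph (labelledOpen ends fun l => z l && decide (Q₂ l))).Reachable c s)) ∧ (¬ (openGraph (labelledOpen ends fun l => clusterFlip ends a (fun y => !(z y && decide (Q₂ y))) l && decide (Q₂ l))).Reachable s a ∧ ¬ (openGraph (labelledOpen ends fun l => clusterFlip ends a (fun y => !(z y && decide (Q₂ y))) l && decide (Q₂ l))).Reachable s c))).card = (univ.filter fun z : α → Bool =>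 ¬ (openGraph (labelledOpen ends fun l => z l && decide (Q₂ l))).Reachable s c).card := by
    congr 1
    apply Finset.filter_congr
    intro z _
    rw [flat_restrict_eq_of_apexFree ends a Q₂ hQ₂a z]
    have h1 := nra z; have h2 := nrc z; have h3 := fun h => (rsym z).mp h; have h4 := fun h => (rsym z).mpr h
    tauto
  have nG1 : (univ.filter fun z : α → Bool => (((¬ (openGraph (labelledOpen ends fun l => z l && decide (Q₂ l))).Reachable s a ∧ ¬ (openGraph (labelledOpen ends fun l => z l && decide (Q₂ l))).Reachable s c) ∧ (¬ (openGraph (labelledOpen ends fun l => z l && decide (Q₂ l))).Reachable c a ∧ ¬ (openGraph (labelledOpen ends fun l => z l && decide (Q₂ l))).Reachable c s)) ∧ ((¬ (openGraph (labelledOpen ends fun l => clusterFlip ends a (fun y => !(z y && decide (Q₂ y))) l && decide (Q₂ l))).Reachable s a ∧ ¬ (openGraph (labelledOpen ends fun l => clusterFlip ends a (fun y => !(z y && decide (Q₂ y))) l && decide (Q₂ l))).Reachable s c) ∧ (¬ (openGraph (labelledOpen ends fun l => clusterFlip ends a (fun y => !(z y && decide (Q₂ y))) l && decide (Q₂ l))).Reachable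 c a ∧ ¬ (openGraph (labelledOpen ends fun l => clusterFlip ends a (fun y => !(z y && decide (Q₂ y))) l && decide (Q₂ l))).Reachable c s)))).card = (univ.filter fun z : α → Bool => ¬ (openGraph (labelledOpen ends fun l => z l && decide (Q₂ l))).Reachable s c).card := by
    congr 1
    apply Finset.filter_congr
    intro z _
    rw [flat_restrict_eq_of_apexFree ends a Q₂ hQ₂a z]
    have h1 := nra z; have h2 := nrc z; have h3 := fun h => (rsym z).mp h; have h4 := fun h => (rsym z).mpr h
    tauto
  -- §§ the product law and the conversions
  have lS0 := card_parallel_S0 ends s a c P₁ P₂ Q₁ Q₂ hQP₁ hQP₂ hPT₁ hPT₂ hP hQ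
  have lC := card_parallel_isoC ends s a c P₁ P₂ Q₁ Q₂ hQP₁ hQP₂ hPT₁ hPT₂ hP hQ
  have lS := card_parallel_isoS ends s a c P₁ P₂ Q₁ Q₂ hQP₁ hQP₂ hPT₁ hPT₂ hP hQ
  have lGa := card_parallel_Ga ends s a c P₁ P₂ Q₁ Q₂ hQP₁ hQP₂ hPT₁ hPT₂ hP hQ
  have lGb := card_parallel_Gb ends s a c P₁ P₂ Q₁ Q₂ hQP₁ hQP₂ hPT₁ hPT₂ hP hQ
  have lG1 := card_parallel_G1 ends s a c P₁ P₂ Q₁ Q₂ hQP₁ hQP₂ hPT₁ hPT₂ hP hQ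
  rw [nS0] at lS0; rw [nisoC] at lC; rw [nisoS] at lS; rw [nGa] at lGa; rw [nGb] at lGb; rw [nG1] at lG1
  have c12a := card_bad_add_good ends s a c (fun l => decide (Q₁ l ∨ Q₂ l))
  have c12b := card_good_add_G1 ends s a c (fun l => decide (Q₁ l ∨ Q₂ l))
  have c12c := card_P1_add_S0 ends s a c (fun l => decide (Q₁ l ∨ Q₂ l))
  have c12d := card_P2_add_S0 ends s a c (fun l => decide (Q₁ l ∨ Q₂ l))
  have c1a := card_bad_add_good ends s a c (fun l => decide (Q₁ l))
  have c1b := card_good_add_G1 ends s a c (fun l => decide (Q₁ l))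
  have c1c := card_P1_add_S0 ends s a c (fun l => decide (Q₁ l))
  have c1d := card_P2_add_S0 ends s a c (fun l => decide (Q₁ l))
  rw [hmQ₁] at key
  -- §§ arithmetic: (bad, P1, P2) of the whole are (bad, P1, P2) of the tree part times N / U
  have hU : 0 < (univ : Finset (α → Bool)).card := Finset.card_pos.mpr Finset.univ_nonempty
  -- §§ unmask: every label is in `Q₁ ∪ Q₂`
  have htrue : ∀ l, decide (Q₁ l ∨ Q₂ l) = true := by
    intro l
    rw [decide_eq_true_eq]
    rcases hlab l with ⟨v, hv, hva, rfl⟩ | ⟨x, hx, hl⟩ | hl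
    · exact Or.inl (Or.inl ⟨v, hv, hva, rfl, anc_a v hv, hva⟩)
    · exact Or.inl (Or.inr ⟨x, anc_a x hx, hl⟩)
    · exact Or.inr hl
  simp only [htrue, Bool.and_true] at lS0 lC lS lGa lGb lG1 c12a c12b c12c c12d
  exact productForm_transfer_arith _ _ _ _ _ _ _ _ _ _ _ _ _ _ _ _ _ _ _ _ _ _ hU c12a c12b c12c c12d c1a c1b c1c c1d
    lS0 lC lS lGa lGb lG1 key

end ApexTree

end Summit.CriticalPhenomena.PercolationContinuityZ3.Theorems.ProductFormFibre
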